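import Mathlib
import HarnessLib
import Summits.SmoothPoincare4.SmoothPoincare4.Theses.TropicalFanoSkeleton

/-!
# Birth skeleton (BC3) — crux `TropicalFanoSkeleton.TropicalCollapse` (stmt-SmoothPoincare4-15643)

Route `route-SmoothPoincare4-TropicalFanoSkeleton` (rescue of LogCYSkeleton), crux #2 `TropicalCollapse` — the
RIGIDITY half of the thesis `X = TropicalBall ∧ TropicalCollapse`: for every smooth 4-manifold `M` (the binders of
`SmoothPoincare4`), every Whitehead smooth triangulation `h : |K| ≃ₜ M` by a finite Euclidean complex
`K ⊆ ℝᴺ`, every vertex `v₀` and every POSITIVE INTEGRAL TROPICAL FAN DATUM `x` on `(K, v₀)` (integer edge vectors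
`x a w ∈ ℤ⁴` making the star of each vertex `a ≠ v₀` a complete projective unimodular fan, all codimension-one
transition monodromies positive Gross–Siebert shears), `M` admits a SKELETON CERTIFICATE: a smooth triangulation
`K'` with a vertex whose antistar `{s ∈ K' | v ∉ s}` simplicially collapses to a vertex.

THE LINE = the route's own foreseen glued split of this node (route header, TWO-LAYER PLAN:
"TropicalCollapse ⇐ FanoSmoothing → RcCollapse (RC general fibre + dFKX Thm 41 + comparison ⇒ antistar has a
collapsible subdivision) → TropicalCollapse (subdivision ⇒ certificate on a refined smooth triangulation)"), typed
WITHOUT new vocabulary.  The algebro-geometric layer (Gross–Siebert reconstruction, rational connectedness of the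
general fibre, de Fernex–Kollár–Xu) has no Lean vocabulary yet (definition requests D-trop / D2 of the route), so its
three informal items are carried by ONE typed stub whose OUTPUT is purely combinatorial — "the antistar of `v₀` has a
finite geometric subdivision that collapses to a vertex" — and the PL/differential plumbing that turns such a
subdivision into a certificate is split into its two genuinely different halves:

* `stub_core_collapsible_subdivision` (C, THE LOAD-BEARING STUB = FanoSmoothing + RcGeneralFibre +
  SkeletonComparison + [dFKX Thm 4], compressed to their combinatorial output): positive integral tropical fan data
  on `(K, v₀)` ⇒ there is a finite Euclidean simplicial complex `K₁ ⊆ ℝᴺ` SUBDIVIDING THE ANTISTAR of `v₀`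
  (`|K₁| = ⋃ {conv s : s ∈ K, v₀ ∉ s}` and every simplex of `K₁` lies in a simplex of `K` missing `v₀`) whose face
  set collapses to a vertex (the crux's own elementary-collapse relation).  Plan (informal, AG): the data are the
  fan picture of a non-compact positive tropical 4-manifold `B = |K| ∖ v₀`; Gross–Siebert reconstruction
  [GrossSiebert2011, Thm 1.29 / Cor 1.30] gives a toric degeneration whose special fibre has dual intersection
  complex the bounded core `antistar(v₀)` and whose general fibre carries an effective anticanonical divisor (the end
  over `lk v₀ = S³`); such a fibre is of Fano type, hence rationally connected, and [FernexKollarXu2012, Thm 4 (= Thm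
  41), proof p. 14; Cor 22] the dual complex of an snc/qdlt model COLLAPSES; the comparison "dual complex of the qdlt
  model = a subdivision of the core" transports the collapse.  Open, crux-hard; why it might fail = the route's own
  line (non-simple / non-polarisable positive data need not come from a degeneration).
* `stub_cone_extension` (E, TRUE and provable, size L; PL topology [RourkeSanderson1972, Ch. 2: subdivisions,
  cones, links and stars]): a finite subdivision `K₁` of the antistar of a vertex `v₀` of a Euclidean simplicial
  complex `K` EXTENDS, by coning the part of `K₁` over `|lk v₀|` from `v₀`, to a finite subdivision `K'` of `K`
  (`|K'| = |K|`, simplices in simplices) with `{v₀} ∈ K'` and antistar of `v₀` in `K'` EXACTLY `K₁`: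
  `{s ∈ K' | v₀ ∉ s} = K₁.faces`.  Why true: `star v₀ = v₀ * lk v₀` is a geometric cone, barycentric coordinates
  along `v₀` are well defined on it (intersection axiom of `K`), so `v₀ * t` (`t ∈ K₁`, `conv t ⊆ |lk v₀|`) are
  affinely independent and meet each other and `K₁` in common faces; `v₀ ∉ |antistar|`.
* `stub_subdivision_smooth` (W, TRUE and provable, size M; [Munkres1966, Def 8.3 / §10], [Whitehead1940, §1]):
  Whitehead smoothness of a triangulation is inherited by finite subdivisions — if `h : |K| ≃ₜ M` is a smooth
  triangulation and `K'` is finite with `|K'| = |K|` and every simplex of `K'` inside a simplex of `K`, then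
  `h ∘ (|K'| = |K|)` is a smooth triangulation (same local extensions `g`, `u`; `vectorSpan t ≤ vectorSpan s` when
  `t ⊆ conv s`, by `affineSpan_convexHull`).
* `tropicalCollapse_of_pieces : C-sig → E-sig → W-sig → (TropicalCollapse unfolded)` — THE REAL COMPOSITION,
  sorry-free: C gives `K₁, w`; E gives `K' ⊇ K₁` with `|K'| = |K|` and antistar `= K₁.faces`; W makes
  `(Homeomorph.setCongr _).trans h : |K'| ≃ₜ M` a smooth triangulation; the certificate is `(N, K', h', v₀, w)` with
  the collapse of `K₁.faces` rewritten along the antistar identity.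
* `TropicalCollapse_of : TropicalCollapse` — THE SKELETON THEOREM: the crux BY NAME from the three declared stubs
  (the file's only theorem whose head symbol is the crux; `ledger skeleton check` shape — the skeleton theorem takes
  no hypotheses other than registered obligations, so the implication content lives in `tropicalCollapse_of_pieces`).

`sorry` occurs ONLY in the three `stub_*` theorems.

## Disproof used

None exists (2026-08-17): `ledger crux ls stmt-SmoothPoincare4-15643` shows no `Disproof.lean`, no `Lines/`, no
landed `Negative/` lemma; `ledger negatives --problem SmoothPoincare4` has no statement about tropical fan data,
subdivisions or collapses; the item's only evidence is the opening planner's `Sketch.lean` (helper-def form, `Iff.rfl`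
with the inline items).  Honoured constraints: no stub is the crux or the summit in costume — C concludes a
collapsible SUBDIVISION OF THE GIVEN ANTISTAR (strictly more specific than the crux's "some smooth triangulation has
a collapsing antistar", and silent about `M`), E and W are true lemmas of PL / differential topology that say nothing
about tropical data or spheres.

## Informal status of the stubs

C ⇒ crux is this file.  Conversely the crux gives C only through deep KNOWN PL topology that the tree lacks
(recognition: certificate ⇒ `M ≅ S⁴`; Whitehead uniqueness of smooth triangulations ⇒ `K` is PL-standard; Newman:
the closed complement of the PL ball `star v₀` in a PL sphere is a PL ball [RourkeSanderson1972, Ch. 3]; a PL ball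
has a collapsible rectilinear subdivision by stellar theory), so C isolates exactly the algebro-geometric content in
combinatorial clothing and is NOT the crux in costume: as typed it is strictly more specific (it subdivides the
GIVEN antistar inside the given `ℝᴺ`).  E and W are theorems of PL / differential topology (true for every `K`),
silent about tropical data and spheres.

## BC3 probes (2026-08-17, farm `lean check`, files `bc/probe_*.lean`, `bc/probe2_core_*.lean` in the registrar's
folder; each imports the route file only, never this file)

For each stub `X` and each target `T ∈ {TropicalCollapse, SmoothPoincare4}`:
`set_option maxHeartbeats 400000 in example : X-sig → T := by first | exact? | simpa | aesop` and the variant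
`intro hX; first | exact? | (simpa using hX) | exact hX | aesop` — ALL 12 FAIL: for E and W `exact?`/`simpa` fail and
`aesop` ends "failed to prove the goal after exhaustive search" / "made no progress" (unsolved goal `⊢ T`); for C the
combinator dies of a heartbeat timeout, so the alternatives were re-run one per example (`bc/probe2_core_*.lean`):
`exact?` (with and without `intro`) reports "could not close the goal", `simpa`, `aesop`, `simpa using hX`,
`intro; aesop` exhaust 400000 heartbeats at `whnf` on both targets.  No stub cheaply gives the crux or the summit.

## References

* M. Gross, B. Siebert, *From real affine geometry to complex geometry*, Ann. of Math. 174 (2011), 1301–1428,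
  arXiv:math/0703822 — Def 1.4 (positivity), §1.1 (monodromy shear), Thm 1.29, Cor 1.30. [GrossSiebert2011]
* T. de Fernex, J. Kollár, C. Xu, *The dual complex of singularities*, Adv. Stud. Pure Math. 74 (2017),
  arXiv:1212.1675 — Thm 4 / Thm 41 (RC general fibre ⇒ dual complex collapsible), Cor 22, Cor 24. [FernexKollarXu2012]
* K. Loginov, *On semistable degenerations of Fano varieties*, arXiv:1909.08319 — Thm 1. [Loginov2019]
* C. P. Rourke, B. J. Sanderson, *Introduction to piecewise-linear topology*, Springer (1972), Ch. 2 (subdivision,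
  cones, stars and links; extension of a subdivision of a subcomplex). [RourkeSanderson1972]
* J. R. Munkres, *Elementary Differential Topology*, Ann. of Math. Stud. 54 (1966), Def 8.3, §10. [Munkres1966]
* J. H. C. Whitehead, *On C¹-complexes*, Ann. of Math. 41 (1940), §1; *Simplicial spaces, nuclei and m-groups*,
  Proc. LMS 45 (1939). [Whitehead1940, Whitehead1939]
-/

-- `Summit.<Summit>.<Problem>`: single-conjunct summit, the duplicate component is mandated (CONVENTIONS §2).
set_option linter.dupNamespace false
set_option linter.unusedVariables false

noncomputable section

namespace Summit.SmoothPoincare4.SmoothPoincare4.Cruxes.TropicalCollapse.Birth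

open scoped BigOperators Topology Manifold Classical MeasureTheory ProbabilityTheory Matrix InnerProductSpace ComplexConjugate ContinuousMap
open Filter Set Function TopologicalSpace MeasureTheory
open Summit.SmoothPoincare4.SmoothPoincare4.Theses.TropicalFanoSkeleton

/-! ## The three registered stubs

Vocabulary (all inline, Mathlib + the route file + `Literature.Topology.FourManifolds.IsSmoothTriangulation`):
`K : Geometry.SimplicialComplex ℝ (EuclideanSpace ℝ (Fin N))`, faces `Finset _`, `K.space = ⋃ conv s`; the
ANTISTAR of `v₀` is the face set `{s ∈ K.faces | v₀ ∉ s}` with polyhedron `⋃ s ∈ {s ∈ K.faces | v₀ ∉ s}, conv s`;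
"`K₁` subdivides the antistar" = `K₁.space =` that polyhedron `∧ ∀ t ∈ K₁.faces, ∃ s ∈ K.faces, v₀ ∉ s ∧ conv t ⊆
conv s`; "collapses to the vertex `w`" = the crux's relation (reflexive–transitive closure of ELEMENTARY COLLAPSES:
remove a free pair `σ ⊂ τ`, `τ` the unique proper coface of `σ`, `#τ = #σ + 1`) from the face set to `{{w}}`; the
positive-integral-tropical-fan-data clause is the crux's, verbatim. -/

/-- **Stub C `stub_core_collapsible_subdivision` — positive tropical fan data force a collapsible subdivision of
the core (the load-bearing stub; FanoSmoothing + RcGeneralFibre + SkeletonComparison + dFKX compressed to their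
combinatorial output).** For every smooth 4-manifold `M`, smooth triangulation `h : |K| ≃ₜ M`, vertex `v₀` and
positive integral tropical fan datum `x` on `(K, v₀)` (the crux's clause verbatim) there is a FINITE Euclidean
simplicial complex `K₁ ⊆ ℝᴺ` with `|K₁| = |antistar v₀|`, every simplex of `K₁` inside a simplex of `K` missing
`v₀`, and a vertex `w` such that `K₁.faces` collapses onto `{w}` by elementary collapses.  Why plausibly true (the
route's AG plan): the data are the fan picture of a positive tropical 4-manifold with one conical end;
Gross–Siebert reconstruction + algebraisation give a toric degeneration with special-fibre dual complex the core
and Fano-type (hence rationally connected) general fibre; de Fernex–Kollár–Xu: for a projective morphism from a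
smooth variety onto a curve with snc special fibre and RC general fibre the dual complex of the special fibre is
collapsible (the `(K+Δ)`-MMP over the base terminates in a Fano contraction and every step is an elementary
collapse); the qdlt comparison identifies that dual complex with a subdivision of `antistar v₀`.  Why it might fail:
positive but NON-SIMPLE / non-polarisable data (the calibration on `∂Δ⁵` has `κ = 5`) need not come from a
degeneration; such data on a vertex-antistar of some `M ≄ S⁴` (Kühnel's `ℂℙ²₉`, small `S² × S²`) would refute it
together with the crux.  Open; size XL / open-problem; strictly MORE SPECIFIC than the crux (it subdivides the
GIVEN antistar and never mentions a new triangulation of `M`).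
[GrossSiebert2011, Thm 1.29, Cor 1.30] [FernexKollarXu2012, Thm 4 = Thm 41, Cor 22] [Loginov2019, Thm 1] -/
theorem stub_core_collapsible_subdivision :
    ∀ (M : Type) [TopologicalSpace M] [T2Space M] [SecondCountableTopology M] [ChartedSpace (EuclideanSpace ℝ
    (Fin 4)) M] [IsManifold (𝓡 4) (⊤ : ℕ∞) M], ∀ (N : ℕ) (K : Geometry.SimplicialComplex ℝ (EuclideanSpace ℝ
    (Fin N))) (h : K.space ≃ₜ M), Literature.Topology.FourManifolds.IsSmoothTriangulation 4 K h → ∀ v₀ :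
    EuclideanSpace ℝ (Fin N), ({v₀} : Finset (EuclideanSpace ℝ (Fin N))) ∈ K.faces → ∀ x : EuclideanSpace ℝ (Fin
    N) → EuclideanSpace ℝ (Fin N) → (Fin 4 → ℝ), ((∀ a w i, ∃ z : ℤ, x a w i = z) ∧ (∀ a, x a a = 0) ∧ (∀ a :
    EuclideanSpace ℝ (Fin N), ({a} : Finset (EuclideanSpace ℝ (Fin N))) ∈ K.faces → a ≠ v₀ → (∀ σ ∈ K.faces, a ∈
    σ → σ.card = 5 → ∀ f : Fin 4 → EuclideanSpace ℝ (Fin N), Function.Injective f → (∀ i, f i ∈ σ.erase a) →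
    |Matrix.det (Matrix.of fun i j => x a (f i) j)| = 1) ∧ (∀ τ ∈ K.faces, ∀ τ' ∈ K.faces, a ∈ τ → a ∈ τ' → {y :
    Fin 4 → ℝ | ∃ c : EuclideanSpace ℝ (Fin N) → ℝ, (∀ w, 0 ≤ c w) ∧ y = ∑ w ∈ (τ).erase a, c w • x a w} ∩ {y :
    Fin 4 → ℝ | ∃ c : EuclideanSpace ℝ (Fin N) → ℝ, (∀ w, 0 ≤ c w) ∧ y = ∑ w ∈ (τ').erase a, c w • x a w} = {y :
    Fin 4 → ℝ | ∃ c : EuclideanSpace ℝ (Fin N) → ℝ, (∀ w, 0 ≤ c w) ∧ y = ∑ w ∈ (τ ∩ τ').erase a, c w • x a w}) ∧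
    (⋃ τ ∈ {τ ∈ K.faces | a ∈ τ}, {y : Fin 4 → ℝ | ∃ c : EuclideanSpace ℝ (Fin N) → ℝ, (∀ w, 0 ≤ c w) ∧ y = ∑ w
    ∈ (τ).erase a, c w • x a w}) = Set.univ ∧ (∃ m : Finset (EuclideanSpace ℝ (Fin N)) → (Fin 4 → ℝ), ∀ σ ∈
    K.faces, ∀ σ' ∈ K.faces, a ∈ σ → a ∈ σ' → σ.card = 5 → σ'.card = 5 → ∀ y ∈ {y : Fin 4 → ℝ | ∃ c :
    EuclideanSpace ℝ (Fin N) → ℝ, (∀ w, 0 ≤ c w) ∧ y = ∑ w ∈ (σ).erase a, c w • x a w}, (∑ i, m σ' i * y i ≤ ∑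
    i, m σ i * y i) ∧ ((∑ i, m σ' i * y i = ∑ i, m σ i * y i) → y ∈ {y : Fin 4 → ℝ | ∃ c : EuclideanSpace ℝ (Fin
    N) → ℝ, (∀ w, 0 ≤ c w) ∧ y = ∑ w ∈ (σ').erase a, c w • x a w}))) ∧ (∀ ρ ∈ K.faces, ρ.card = 4 → ∀ σp ∈
    K.faces, ∀ σm ∈ K.faces, σp.card = 5 → σm.card = 5 → ρ ⊆ σp → ρ ⊆ σm → σp ≠ σm → ∀ a ∈ ρ, ∀ b ∈ ρ, a ≠ b → a
    ≠ v₀ → b ≠ v₀ → ∀ ψp ψm : (Fin 4 → ℝ) →ᵃ[ℝ] (Fin 4 → ℝ), (∀ w ∈ σp, w ≠ v₀ → ψp (x a w) = x b w) → (v₀ ∈ σp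
    → ψp.linear (x a v₀) = x b v₀) → (∀ w ∈ σm, w ≠ v₀ → ψm (x a w) = x b w) → (v₀ ∈ σm → ψm.linear (x a v₀) = x
    b v₀) → ∀ wp ∈ σp, wp ∉ ρ → ∀ g : Fin 3 → EuclideanSpace ℝ (Fin N), Function.Injective g → (∀ i, g i ∈
    ρ.erase a) → ∃ κ : ℝ, 0 ≤ κ ∧ ∀ y : Fin 4 → ℝ, ψp y = ψm (y + (κ * Matrix.det (Matrix.of ![y, x a (g 0), x a
    (g 1), x a (g 2)]) * Matrix.det (Matrix.of ![x a wp, x a (g 0), x a (g 1), x a (g 2)])) • x a b))) → ∃ K₁ :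
    Geometry.SimplicialComplex ℝ (EuclideanSpace ℝ (Fin N)), K₁.faces.Finite ∧ K₁.space = (⋃ s ∈ {s ∈ K.faces |
    v₀ ∉ s}, convexHull ℝ (s : Set (EuclideanSpace ℝ (Fin N)))) ∧ (∀ t ∈ K₁.faces, ∃ s ∈ K.faces, v₀ ∉ s ∧
    convexHull ℝ (t : Set (EuclideanSpace ℝ (Fin N))) ⊆ convexHull ℝ (s : Set (EuclideanSpace ℝ (Fin N)))) ∧ ∃ w
    : EuclideanSpace ℝ (Fin N), Relation.ReflTransGen (fun F G : Set (Finset (EuclideanSpace ℝ (Fin N))) => ∃ σ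
    τ : Finset (EuclideanSpace ℝ (Fin N)), (σ ∈ F ∧ τ ∈ F ∧ σ ⊂ τ ∧ τ.card = σ.card + 1 ∧ ∀ ρ ∈ F, σ ⊂ ρ → ρ =
    τ) ∧ G = F \ {σ, τ}) K₁.faces {({w} : Finset (EuclideanSpace ℝ (Fin N)))} := by
  sorry

/-- **Stub E `stub_cone_extension` — a finite subdivision of a vertex-antistar extends to a finite subdivision
of the whole complex with the SAME antistar (TRUE; PL topology, coning from `v₀`).** For a Euclidean simplicial
complex `K ⊆ ℝᴺ`, a vertex `v₀` of `K` and a finite complex `K₁` with `|K₁| = |antistar v₀|` and every simplex of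
`K₁` inside a simplex of `K` missing `v₀`, there is a finite complex `K'` with `|K'| = |K|`, every simplex of `K'`
inside a simplex of `K`, `{v₀} ∈ K'`, and `{s ∈ K' | v₀ ∉ s} = K₁.faces` on the nose.  Why true: put
`K' := K₁ ∪ {{v₀}} ∪ {insert v₀ t | t ∈ K₁, conv t ⊆ |lk v₀|}`.  Every point of `|lk v₀| ⊆ |K₁|` lies in a simplex
`t ∈ K₁` with `conv t ⊆ |lk v₀|` (carrier faces; `lk v₀` is a full subcomplex of the antistar), so
`|K'| ⊇ v₀ * |lk v₀| = |star v₀|`; `v₀ ∉ affineSpan t` because `t ⊆ conv s''` for a link simplex `s''` with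
`insert v₀ s'' ∈ K`, so cones are simplices; two cones, or a cone and a simplex of `K₁`, meet in a common face
because the `v₀`-barycentric coordinate is well defined on `|star v₀|` (intersection axiom of `K`) and
`|star v₀| ∩ |antistar v₀| = |lk v₀|`; finally `v₀ ∉ |antistar v₀|` (`conv {v₀} ∩ conv s = conv (∅)`), so no simplex
of `K₁` contains `v₀`.  Size L in Lean (a `Geometry.SimplicialComplex` built by hand: affine independence of cones,
the two intersection computations, the polyhedron identity).  No finiteness of `K` is needed.
[RourkeSanderson1972, Ch. 2 (cones, joins, subdivision of stars)] [Whitehead1939] -/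
theorem stub_cone_extension :
    ∀ (N : ℕ) (K : Geometry.SimplicialComplex ℝ (EuclideanSpace ℝ (Fin N))) (v₀ : EuclideanSpace ℝ (Fin N)),
    ({v₀} : Finset (EuclideanSpace ℝ (Fin N))) ∈ K.faces → ∀ K₁ : Geometry.SimplicialComplex ℝ (EuclideanSpace ℝ
    (Fin N)), K₁.faces.Finite → K₁.space = (⋃ s ∈ {s ∈ K.faces | v₀ ∉ s}, convexHull ℝ (s : Set (EuclideanSpace
    ℝ (Fin N)))) → (∀ t ∈ K₁.faces, ∃ s ∈ K.faces, v₀ ∉ s ∧ convexHull ℝ (t : Set (EuclideanSpace ℝ (Fin N))) ⊆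
    convexHull ℝ (s : Set (EuclideanSpace ℝ (Fin N)))) → ∃ K' : Geometry.SimplicialComplex ℝ (EuclideanSpace ℝ
    (Fin N)), K'.faces.Finite ∧ K'.space = K.space ∧ (∀ t ∈ K'.faces, ∃ s ∈ K.faces, convexHull ℝ (t : Set
    (EuclideanSpace ℝ (Fin N))) ⊆ convexHull ℝ (s : Set (EuclideanSpace ℝ (Fin N)))) ∧ ({v₀} : Finset
    (EuclideanSpace ℝ (Fin N))) ∈ K'.faces ∧ {s ∈ K'.faces | v₀ ∉ s} = K₁.faces := by
  sorry

/-- **Stub W `stub_subdivision_smooth` — Whitehead smoothness passes to finite subdivisions (TRUE; differential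
topology bookkeeping of size M, but a genuine lemma the tree lacks).** If `h : |K| ≃ₜ M` is a Whitehead smooth
triangulation (`Literature.Topology.FourManifolds.IsSmoothTriangulation 4 K h`: finitely many faces; on each closed
simplex `h` extends to a `C^∞` map `g` of an open `u ⊇ conv s` with `mfderiv g x` injective on `vectorSpan s`) and
`K'` is a finite complex in the same `ℝᴺ` with `|K'| = |K|` and every simplex of `K'` inside a simplex of `K`, then
`h` re-read on `|K'|` — `(Homeomorph.setCongr hKK').trans h` — is a smooth triangulation by `K'`.  Why true: for
`t ∈ K'` pick `s ∈ K` with `conv t ⊆ conv s` and reuse `(g, u)`: `u ⊇ conv s ⊇ conv t`, `h = g` on `conv t`, and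
`vectorSpan ℝ t ≤ vectorSpan ℝ (conv s) = vectorSpan ℝ s` (`vectorSpan_mono`, `affineSpan_convexHull`), so
injectivity on the smaller direction space is inherited (`Set.InjOn.mono`).  Stated for the model `ℝ⁴` only and
with the minimal instances (`TopologicalSpace`, `ChartedSpace`), which is all `IsSmoothTriangulation` uses.
[Munkres1966, Def 8.3] [Whitehead1940, §1] -/
theorem stub_subdivision_smooth :
    ∀ (M : Type) [TopologicalSpace M] [ChartedSpace (EuclideanSpace ℝ (Fin 4)) M], ∀ (N : ℕ) (K K' :
    Geometry.SimplicialComplex ℝ (EuclideanSpace ℝ (Fin N))) (h : K.space ≃ₜ M),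
    Literature.Topology.FourManifolds.IsSmoothTriangulation 4 K h → K'.faces.Finite → ∀ hKK' : K'.space =
    K.space, (∀ t ∈ K'.faces, ∃ s ∈ K.faces, convexHull ℝ (t : Set (EuclideanSpace ℝ (Fin N))) ⊆ convexHull ℝ (s
    : Set (EuclideanSpace ℝ (Fin N)))) → Literature.Topology.FourManifolds.IsSmoothTriangulation 4 K'
    ((Homeomorph.setCongr hKK').trans h) := by
  sorry

/-! ## The composition: the three stubs prove the crux -/

/-- **Composition with explicit hypotheses** (`C-sig → E-sig → W-sig → TropicalCollapse` unfolded, so that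
`TropicalCollapse_of` below is the file's only theorem whose head symbol is the crux name).  Proof: C gives a finite
subdivision `K₁` of `antistar v₀` collapsing to `{w}`; E extends it to a finite subdivision `K'` of `K` with
`{v₀} ∈ K'` and `{s ∈ K' | v₀ ∉ s} = K₁.faces`; W says `h' := (Homeomorph.setCongr _).trans h : |K'| ≃ₜ M` is a
smooth triangulation; the certificate is `⟨N, K', h', _, v₀, _, w, _⟩`, the collapse being that of `K₁.faces`
transported along the antistar identity.  Sorry-free, standard axioms. [folklore] -/
theorem tropicalCollapse_of_pieces
    (hC : ∀ (M : Type) [TopologicalSpace M] [T2Space M] [SecondCountableTopology M] [ChartedSpace (EuclideanSpace ℝ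
      (Fin 4)) M] [IsManifold (𝓡 4) (⊤ : ℕ∞) M], ∀ (N : ℕ) (K : Geometry.SimplicialComplex ℝ (EuclideanSpace ℝ
      (Fin N))) (h : K.space ≃ₜ M), Literature.Topology.FourManifolds.IsSmoothTriangulation 4 K h → ∀ v₀ :
      EuclideanSpace ℝ (Fin N), ({v₀} : Finset (EuclideanSpace ℝ (Fin N))) ∈ K.faces → ∀ x : EuclideanSpace ℝ
      (Fin N) → EuclideanSpace ℝ (Fin N) → (Fin 4 → ℝ), ((∀ a w i, ∃ z : ℤ, x a w i = z) ∧ (∀ a, x a a = 0) ∧ (∀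
      a : EuclideanSpace ℝ (Fin N), ({a} : Finset (EuclideanSpace ℝ (Fin N))) ∈ K.faces → a ≠ v₀ → (∀ σ ∈
      K.faces, a ∈ σ → σ.card = 5 → ∀ f : Fin 4 → EuclideanSpace ℝ (Fin N), Function.Injective f → (∀ i, f i ∈
      σ.erase a) → |Matrix.det (Matrix.of fun i j => x a (f i) j)| = 1) ∧ (∀ τ ∈ K.faces, ∀ τ' ∈ K.faces, a ∈ τ
      → a ∈ τ' → {y : Fin 4 → ℝ | ∃ c : EuclideanSpace ℝ (Fin N) → ℝ, (∀ w, 0 ≤ c w) ∧ y = ∑ w ∈ (τ).erase a, c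
      w • x a w} ∩ {y : Fin 4 → ℝ | ∃ c : EuclideanSpace ℝ (Fin N) → ℝ, (∀ w, 0 ≤ c w) ∧ y = ∑ w ∈ (τ').erase a,
      c w • x a w} = {y : Fin 4 → ℝ | ∃ c : EuclideanSpace ℝ (Fin N) → ℝ, (∀ w, 0 ≤ c w) ∧ y = ∑ w ∈ (τ ∩
      τ').erase a, c w • x a w}) ∧ (⋃ τ ∈ {τ ∈ K.faces | a ∈ τ}, {y : Fin 4 → ℝ | ∃ c : EuclideanSpace ℝ (Fin N)
      → ℝ, (∀ w, 0 ≤ c w) ∧ y = ∑ w ∈ (τ).erase a, c w • x a w}) = Set.univ ∧ (∃ m : Finset (EuclideanSpace ℝ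
      (Fin N)) → (Fin 4 → ℝ), ∀ σ ∈ K.faces, ∀ σ' ∈ K.faces, a ∈ σ → a ∈ σ' → σ.card = 5 → σ'.card = 5 → ∀ y ∈
      {y : Fin 4 → ℝ | ∃ c : EuclideanSpace ℝ (Fin N) → ℝ, (∀ w, 0 ≤ c w) ∧ y = ∑ w ∈ (σ).erase a, c w • x a w},
      (∑ i, m σ' i * y i ≤ ∑ i, m σ i * y i) ∧ ((∑ i, m σ' i * y i = ∑ i, m σ i * y i) → y ∈ {y : Fin 4 → ℝ | ∃
      c : EuclideanSpace ℝ (Fin N) → ℝ, (∀ w, 0 ≤ c w) ∧ y = ∑ w ∈ (σ').erase a, c w • x a w}))) ∧ (∀ ρ ∈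
      K.faces, ρ.card = 4 → ∀ σp ∈ K.faces, ∀ σm ∈ K.faces, σp.card = 5 → σm.card = 5 → ρ ⊆ σp → ρ ⊆ σm → σp ≠
      σm → ∀ a ∈ ρ, ∀ b ∈ ρ, a ≠ b → a ≠ v₀ → b ≠ v₀ → ∀ ψp ψm : (Fin 4 → ℝ) →ᵃ[ℝ] (Fin 4 → ℝ), (∀ w ∈ σp, w ≠
      v₀ → ψp (x a w) = x b w) → (v₀ ∈ σp → ψp.linear (x a v₀) = x b v₀) → (∀ w ∈ σm, w ≠ v₀ → ψm (x a w) = x b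
      w) → (v₀ ∈ σm → ψm.linear (x a v₀) = x b v₀) → ∀ wp ∈ σp, wp ∉ ρ → ∀ g : Fin 3 → EuclideanSpace ℝ (Fin N),
      Function.Injective g → (∀ i, g i ∈ ρ.erase a) → ∃ κ : ℝ, 0 ≤ κ ∧ ∀ y : Fin 4 → ℝ, ψp y = ψm (y + (κ *
      Matrix.det (Matrix.of ![y, x a (g 0), x a (g 1), x a (g 2)]) * Matrix.det (Matrix.of ![x a wp, x a (g 0),
      x a (g 1), x a (g 2)])) • x a b))) → ∃ K₁ : Geometry.SimplicialComplex ℝ (EuclideanSpace ℝ (Fin N)),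
      K₁.faces.Finite ∧ K₁.space = (⋃ s ∈ {s ∈ K.faces | v₀ ∉ s}, convexHull ℝ (s : Set (EuclideanSpace ℝ (Fin
      N)))) ∧ (∀ t ∈ K₁.faces, ∃ s ∈ K.faces, v₀ ∉ s ∧ convexHull ℝ (t : Set (EuclideanSpace ℝ (Fin N))) ⊆
      convexHull ℝ (s : Set (EuclideanSpace ℝ (Fin N)))) ∧ ∃ w : EuclideanSpace ℝ (Fin N), Relation.ReflTransGen
      (fun F G : Set (Finset (EuclideanSpace ℝ (Fin N))) => ∃ σ τ : Finset (EuclideanSpace ℝ (Fin N)), (σ ∈ F ∧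
      τ ∈ F ∧ σ ⊂ τ ∧ τ.card = σ.card + 1 ∧ ∀ ρ ∈ F, σ ⊂ ρ → ρ = τ) ∧ G = F \ {σ, τ}) K₁.faces {({w} : Finset
      (EuclideanSpace ℝ (Fin N)))})
    (hE : ∀ (N : ℕ) (K : Geometry.SimplicialComplex ℝ (EuclideanSpace ℝ (Fin N))) (v₀ : EuclideanSpace ℝ (Fin N)),
      ({v₀} : Finset (EuclideanSpace ℝ (Fin N))) ∈ K.faces → ∀ K₁ : Geometry.SimplicialComplex ℝ (EuclideanSpace
      ℝ (Fin N)), K₁.faces.Finite → K₁.space = (⋃ s ∈ {s ∈ K.faces | v₀ ∉ s}, convexHull ℝ (s : Set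
      (EuclideanSpace ℝ (Fin N)))) → (∀ t ∈ K₁.faces, ∃ s ∈ K.faces, v₀ ∉ s ∧ convexHull ℝ (t : Set
      (EuclideanSpace ℝ (Fin N))) ⊆ convexHull ℝ (s : Set (EuclideanSpace ℝ (Fin N)))) → ∃ K' :
      Geometry.SimplicialComplex ℝ (EuclideanSpace ℝ (Fin N)), K'.faces.Finite ∧ K'.space = K.space ∧ (∀ t ∈
      K'.faces, ∃ s ∈ K.faces, convexHull ℝ (t : Set (EuclideanSpace ℝ (Fin N))) ⊆ convexHull ℝ (s : Set
      (EuclideanSpace ℝ (Fin N)))) ∧ ({v₀} : Finset (EuclideanSpace ℝ (Fin N))) ∈ K'.faces ∧ {s ∈ K'.faces | v₀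
      ∉ s} = K₁.faces)
    (hW : ∀ (M : Type) [TopologicalSpace M] [ChartedSpace (EuclideanSpace ℝ (Fin 4)) M], ∀ (N : ℕ) (K K' :
      Geometry.SimplicialComplex ℝ (EuclideanSpace ℝ (Fin N))) (h : K.space ≃ₜ M),
      Literature.Topology.FourManifolds.IsSmoothTriangulation 4 K h → K'.faces.Finite → ∀ hKK' : K'.space =
      K.space, (∀ t ∈ K'.faces, ∃ s ∈ K.faces, convexHull ℝ (t : Set (EuclideanSpace ℝ (Fin N))) ⊆ convexHull ℝ
      (s : Set (EuclideanSpace ℝ (Fin N)))) → Literature.Topology.FourManifolds.IsSmoothTriangulation 4 K'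
      ((Homeomorph.setCongr hKK').trans h)) :
    ∀ (M : Type) [TopologicalSpace M] [T2Space M] [SecondCountableTopology M] [ChartedSpace (EuclideanSpace ℝ
    (Fin 4)) M] [IsManifold (𝓡 4) (⊤ : ℕ∞) M], ∀ (N : ℕ) (K : Geometry.SimplicialComplex ℝ (EuclideanSpace ℝ
    (Fin N))) (h : K.space ≃ₜ M), Literature.Topology.FourManifolds.IsSmoothTriangulation 4 K h → ∀ v₀ :
    EuclideanSpace ℝ (Fin N), ({v₀} : Finset (EuclideanSpace ℝ (Fin N))) ∈ K.faces → ∀ x : EuclideanSpace ℝ (Fin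
    N) → EuclideanSpace ℝ (Fin N) → (Fin 4 → ℝ), ((∀ a w i, ∃ z : ℤ, x a w i = z) ∧ (∀ a, x a a = 0) ∧ (∀ a :
    EuclideanSpace ℝ (Fin N), ({a} : Finset (EuclideanSpace ℝ (Fin N))) ∈ K.faces → a ≠ v₀ → (∀ σ ∈ K.faces, a ∈
    σ → σ.card = 5 → ∀ f : Fin 4 → EuclideanSpace ℝ (Fin N), Function.Injective f → (∀ i, f i ∈ σ.erase a) →
    |Matrix.det (Matrix.of fun i j => x a (f i) j)| = 1) ∧ (∀ τ ∈ K.faces, ∀ τ' ∈ K.faces, a ∈ τ → a ∈ τ' → {y :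
    Fin 4 → ℝ | ∃ c : EuclideanSpace ℝ (Fin N) → ℝ, (∀ w, 0 ≤ c w) ∧ y = ∑ w ∈ (τ).erase a, c w • x a w} ∩ {y :
    Fin 4 → ℝ | ∃ c : EuclideanSpace ℝ (Fin N) → ℝ, (∀ w, 0 ≤ c w) ∧ y = ∑ w ∈ (τ').erase a, c w • x a w} = {y :
    Fin 4 → ℝ | ∃ c : EuclideanSpace ℝ (Fin N) → ℝ, (∀ w, 0 ≤ c w) ∧ y = ∑ w ∈ (τ ∩ τ').erase a, c w • x a w}) ∧
    (⋃ τ ∈ {τ ∈ K.faces | a ∈ τ}, {y : Fin 4 → ℝ | ∃ c : EuclideanSpace ℝ (Fin N) → ℝ, (∀ w, 0 ≤ c w) ∧ y = ∑ w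
    ∈ (τ).erase a, c w • x a w}) = Set.univ ∧ (∃ m : Finset (EuclideanSpace ℝ (Fin N)) → (Fin 4 → ℝ), ∀ σ ∈
    K.faces, ∀ σ' ∈ K.faces, a ∈ σ → a ∈ σ' → σ.card = 5 → σ'.card = 5 → ∀ y ∈ {y : Fin 4 → ℝ | ∃ c :
    EuclideanSpace ℝ (Fin N) → ℝ, (∀ w, 0 ≤ c w) ∧ y = ∑ w ∈ (σ).erase a, c w • x a w}, (∑ i, m σ' i * y i ≤ ∑
    i, m σ i * y i) ∧ ((∑ i, m σ' i * y i = ∑ i, m σ i * y i) → y ∈ {y : Fin 4 → ℝ | ∃ c : EuclideanSpace ℝ (Fin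
    N) → ℝ, (∀ w, 0 ≤ c w) ∧ y = ∑ w ∈ (σ').erase a, c w • x a w}))) ∧ (∀ ρ ∈ K.faces, ρ.card = 4 → ∀ σp ∈
    K.faces, ∀ σm ∈ K.faces, σp.card = 5 → σm.card = 5 → ρ ⊆ σp → ρ ⊆ σm → σp ≠ σm → ∀ a ∈ ρ, ∀ b ∈ ρ, a ≠ b → a
    ≠ v₀ → b ≠ v₀ → ∀ ψp ψm : (Fin 4 → ℝ) →ᵃ[ℝ] (Fin 4 → ℝ), (∀ w ∈ σp, w ≠ v₀ → ψp (x a w) = x b w) → (v₀ ∈ σp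
    → ψp.linear (x a v₀) = x b v₀) → (∀ w ∈ σm, w ≠ v₀ → ψm (x a w) = x b w) → (v₀ ∈ σm → ψm.linear (x a v₀) = x
    b v₀) → ∀ wp ∈ σp, wp ∉ ρ → ∀ g : Fin 3 → EuclideanSpace ℝ (Fin N), Function.Injective g → (∀ i, g i ∈
    ρ.erase a) → ∃ κ : ℝ, 0 ≤ κ ∧ ∀ y : Fin 4 → ℝ, ψp y = ψm (y + (κ * Matrix.det (Matrix.of ![y, x a (g 0), x a
    (g 1), x a (g 2)]) * Matrix.det (Matrix.of ![x a wp, x a (g 0), x a (g 1), x a (g 2)])) • x a b))) → ∃ (N' :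
    ℕ) (K' : Geometry.SimplicialComplex ℝ (EuclideanSpace ℝ (Fin N'))) (h' : K'.space ≃ₜ M),
    Literature.Topology.FourManifolds.IsSmoothTriangulation 4 K' h' ∧ ∃ v : EuclideanSpace ℝ (Fin N'), ({v} :
    Finset (EuclideanSpace ℝ (Fin N'))) ∈ K'.faces ∧ ∃ w : EuclideanSpace ℝ (Fin N'), Relation.ReflTransGen (fun
    F G : Set (Finset (EuclideanSpace ℝ (Fin N'))) => ∃ σ τ : Finset (EuclideanSpace ℝ (Fin N')), (σ ∈ F ∧ τ ∈ F
    ∧ σ ⊂ τ ∧ τ.card = σ.card + 1 ∧ ∀ ρ ∈ F, σ ⊂ ρ → ρ = τ) ∧ G = F \ {σ, τ}) {s ∈ K'.faces | v ∉ s} {({w} :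
    Finset (EuclideanSpace ℝ (Fin N')))} := by
  intro M _ _ _ _ _ N K h hK v₀ hv₀ x hx
  -- C: a finite subdivision K₁ of the antistar of v₀ whose face set collapses onto the vertex w
  obtain ⟨K₁, hK₁fin, hK₁sp, hK₁sub, w, hcoll⟩ := hC M N K h hK v₀ hv₀ x hx
  -- E: cone it off from v₀ to a finite subdivision K' of K with antistar exactly K₁
  obtain ⟨K', hK'fin, hK'sp, hK'sub, hv₀', hanti⟩ := hE N K v₀ hv₀ K₁ hK₁fin hK₁sp hK₁sub
  -- W: h re-read on |K'| = |K| is a smooth triangulation by K'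
  have hsm := hW M N K K' h hK hK'fin hK'sp hK'sub
  refine ⟨N, K', (Homeomorph.setCongr hK'sp).trans h, hsm, v₀, hv₀', w, ?_⟩
  rw [hanti]
  exact hcoll

/-- **THE SKELETON THEOREM.** The crux
`Summit.SmoothPoincare4.SmoothPoincare4.Theses.TropicalFanoSkeleton.TropicalCollapse`, concluded BY NAME from the
three DECLARED stubs `stub_core_collapsible_subdivision`, `stub_cone_extension`, `stub_subdivision_smooth` (the only
`sorry`s of the file) through the sorry-free composition `tropicalCollapse_of_pieces` (the stubs' statements are
syntactically the composition's hypotheses). [folklore] -/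
theorem TropicalCollapse_of :
    Summit.SmoothPoincare4.SmoothPoincare4.Theses.TropicalFanoSkeleton.TropicalCollapse :=
  tropicalCollapse_of_pieces stub_core_collapsible_subdivision stub_cone_extension stub_subdivision_smooth

end Summit.SmoothPoincare4.SmoothPoincare4.Cruxes.TropicalCollapse.Birth
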